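import Summits.AtomisticToContinuum.FouriersLaw.Theses.EmbeddedDrudeMourre
import Literature.MathematicalPhysics.KineticTheory.HarmonicChaosDecomposition
import Literature.MathematicalPhysics.KineticTheory.ZeroWavenumberSpace
import Literature.MathematicalPhysics.KineticTheory.InfiniteChainInvariantStates
import Literature.MathematicalPhysics.KineticTheory.InfiniteChainSuperstableDynamics
import Literature.MathematicalPhysics.KineticTheory.InfiniteChainGoodSetSymmetries
import Summits.AtomisticToContinuum.FouriersLaw.Theorems.EmbeddedDrudeMourreDrudeDissolutionStubPencilDerivation
import Summits.AtomisticToContinuum.FouriersLaw.Theorems.EmbeddedDrudeMourreDrudeDissolutionStubWickShellDynamicGronwall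
import Summits.AtomisticToContinuum.FouriersLaw.Theorems.EmbeddedDrudeMourreDrudeDissolutionStubWickShellDynamicChaos
import Summits.AtomisticToContinuum.FouriersLaw.Theorems.EmbeddedDrudeMourreDrudeDissolutionStubWickShellDynamicBounds
import Summits.AtomisticToContinuum.FouriersLaw.Theorems.EmbeddedDrudeMourreDrudeDissolutionStubWickShellDynamicFluct
import HarnessLib

/-!
# Stub K6 `stub_wickShellDynamic`: the harmonic spectral formula for Wick polynomials
(line `gram-pencil-harmonic-chaos`, crux `EmbeddedDrudeMourre.DrudeDissolution`, item stmt-AtomisticToContinuum-12593;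
`--supports` file proving the registered stub K6 verbatim, closes nothing)

WHAT. For the harmonic chain `pinnedChain ω₂ 0 0 1` (`ω₂ > 0`) and ANY zero-wavenumber datum `(D, Z)` with the clauses
the landed framework stub F delivers (DLR state at `T = 1`, `carrier = bmGood`, flow `= id` off `bmGood`, strongly
continuous Koopman group, `localObs = span{u ∘ φ_s : u ∈ 𝒫}`), and any presented Wick polynomial
`P = Σ_j c_j :φ(f_{j0})⋯φ(f_{j3}): + Σ_j d_j :φ(g_{j0})φ(g_{j1}): + c₀`, the autocorrelation in Doyon's form is the
matrix coefficient of the FREE chaos Koopman group at the chaos vector of the presentation: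
`Z.form P (P ∘ φ_t) = Re ⟪Ψ_P, chaosKoopman ω₂ t Ψ_P⟫`, `Ψ_P = Σ_j c_j • wickVector ω₂ 1 f_j + Σ_j d_j • wickVector ω₂ 1 g_j`
— given, as hypotheses by name (expanded), the static shell formula K2 (`Σ_y Cov(:f:, :g: ∘ τ_y) = Re ⟪ι[:f:], ι[:g:]⟫`
for degrees in `{2, 4}`) and the pencil algebra KAlg (`𝓛₀` acts on Wick products slot by slot through the lattice
Klein–Gordon map `L`, `w_{Lf} = −iω w_f`).

HOW (ODE uniqueness in `ℋ₀`, no pointwise identification of the Buttà–Marchioro flow). `form_wick_comp_flow_eq_re_inner`: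
for fixed `P` and EVERY Wick monomial `v = :h₀⋯h_{N−1}:`, `N ∈ {2,4}`, put
`G_h(t) = Z.form P (v ∘ φ_t) − Re ⟪Ψ_P, U⁰_t ι[v]⟫`. Then (i) `G_h(0) = 0` by K2 and bilinearity
(`form_presentation_left`, `re_inner_presentation`); (ii) `G_h' (t) = Σ_k G_{h[k ← Lh_k]}(t)`: on the left the landed
generator stub C (`stub_pencilDerivation_domain`: `d/ds U_s[v] = [𝓛₀ v]` at `0`) transported along the group
(`hasDerivAt_inner_koopman_fluct`) and KAlg (b); on the right the slot rule `Σ_k ι[:h[k←Lh_k]:] = (iΩ)ι[:h:]` sectorwise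
(`hasDerivAt_inner_wickVector_chaosKoopman`, from KAlg (c)); (iii) `|G_h(t)| ≤ M Π_i B(h_i)`, `B(f) = sup‖w_f‖`, by
Cauchy–Schwarz (`‖[v]‖₀ = ‖ι[v]‖` by K2, `norm_wickVector_le`) and (iv) `Σ_k Π_i B((h[k←Lh_k])_i) ≤ N√(|ω₂|+4) Π_i B(h_i)`
(`sum_prod_ciSup_update_le`); so `G ≡ 0` by the iterated Grönwall lemma `linear_ode_family_eq_zero`. The registered
statement follows by linearity in the second slot on both sides (`form_presentation_comp_right`,
`re_inner_chaosKoopman_presentation`). [cite: Doyon2022, §4.2–4.3 Thm 4.11] [cite: Janson1997, Thm 4.5]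
-/

noncomputable section

namespace Summit.AtomisticToContinuum.FouriersLaw.Theorems.DrudeDissolution.GramPencilHarmonicChaos

open MeasureTheory Filter Set Function Topology
open scoped InnerProductSpace ENNReal ComplexConjugate
open Literature.MathematicalPhysics.KineticTheory
open Literature.MathematicalPhysics.KineticTheory.HeatConduction
open Literature.MathematicalPhysics.KineticTheory.PhononBoltzmann
open HarmonicChaos ProbabilityTheory
open PinnedChainKinetic (𝕋 𝕋3 μ𝕋 μ𝕋3 k₄ sinT)
open scoped Literature.MathematicalPhysics.KineticTheory.HeatConduction.PinnedChainKinetic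

section Core

variable {ω₂ : ℝ} {D : InfiniteChainDynamics (pinnedChain ω₂ 0 0 1)}

/-- **The harmonic spectral formula for Wick MONOMIALS against a presented polynomial** (the core of stub K6):
for every Wick monomial `v = :φ(h₀)⋯φ(h_{N−1}):` of degree `N ∈ {2, 4}`,
`Z.form P (v ∘ φ_t) = Re ⟪Ψ_P, U⁰_t ι[v]⟫` — by ODE uniqueness (`linear_ode_family_eq_zero`) for the family
`G_h(t) = Z.form P (:h: ∘ φ_t) − Re ⟪Ψ_P, U⁰_t ι[:h:]⟫` indexed by all `h : Fin N → TestFn`: `G_h(0) = 0` by the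
static shell formula (K2), `G_h' = Σ_k G_{h[k ← Lh_k]}` by the landed generator stub C on the left and the slot
rule on the right, `|G_h| ≤ M Π_i B(h_i)` by Cauchy–Schwarz and the norm bounds. [cite: Doyon2022, §4.2–4.3 Thm 4.11] -/
theorem form_wick_comp_flow_eq_re_inner (hω : 0 < ω₂) (Z : ZeroWavenumberData (pinnedChain ω₂ 0 0 1) D)
    (hK2Z : ∀ (N M : ℕ) (f : Fin N → TestFn) (g : Fin M → TestFn), (N = 2 ∨ N = 4) → (M = 2 ∨ M = 4) →
        Summable (fun y : ℤ => cov[wick ω₂ 1 N f, wick ω₂ 1 M g ∘ chainShift y; Z.μ]) ∧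
        ∑' y : ℤ, cov[wick ω₂ 1 N f, wick ω₂ 1 M g ∘ chainShift y; Z.μ] =
          (⟪wickVector ω₂ 1 f, wickVector ω₂ 1 g⟫_ℂ).re)
    (hmemP : ∀ (N : ℕ) (h : Fin N → TestFn), wick ω₂ 1 N h ∈ Algebra.adjoin ℝ
      (Set.range fun xc : ℤ × Bool => fun σ : ChainConfig => if xc.2 then (σ xc.1).2 else (σ xc.1).1))
    {L : TestFn → TestFn}
    (hLiou : ∀ (N : ℕ) (h : Fin N → TestFn), liouvilleZ (pinnedChain ω₂ 0 0 1) (wick ω₂ 1 N h) =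
      ∑ i, wick ω₂ 1 N (Function.update h i (L (h i))))
    (hwave : ∀ (θ : TestFn) (k : 𝕋), thermalWave ω₂ 1 (L θ) k =
      -Complex.I * (PinnedChainKinetic.dispersion ω₂ k : ℂ) * thermalWave ω₂ 1 θ k)
    (hcar : D.carrier = (pinnedChain ω₂ 0 0 1).bmGood)
    (hoff : ∀ (t : ℝ) (σ : ChainConfig), σ ∉ (pinnedChain ω₂ 0 0 1).bmGood → D.flow t σ = σ)
    (hU : Z.toFluctuationDynamics.IsStronglyContinuous)
    (hloc : Z.localObs = Submodule.span ℝ {w : ChainConfig → ℝ | ∃ u ∈ Algebra.adjoin ℝ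
      (Set.range fun xc : ℤ × Bool => fun σ : ChainConfig => if xc.2 then (σ xc.1).2 else (σ xc.1).1),
      ∃ s : ℝ, w = u ∘ D.flow s})
    {J J' : ℕ} (c : Fin J → ℝ) (f : Fin J → Fin 4 → TestFn) (d : Fin J' → ℝ) (g : Fin J' → Fin 2 → TestFn)
    (c₀ : ℝ) {N : ℕ} (hN : N = 2 ∨ N = 4) (h : Fin N → TestFn) (t : ℝ) :
    Z.form (fun σ : ChainConfig => (∑ j : Fin J, c j * wick ω₂ 1 4 (f j) σ) +
        (∑ j : Fin J', d j * wick ω₂ 1 2 (g j) σ) + c₀) (wick ω₂ 1 N h ∘ D.flow t) =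
      (⟪(∑ j, (c j : ℂ) • wickVector ω₂ 1 (f j)) + ∑ j, (d j : ℂ) • wickVector ω₂ 1 (g j),
        chaosKoopman ω₂ t (wickVector ω₂ 1 h)⟫_ℂ).re := by
  classical
  have h4 : (4 : ℕ) = 2 ∨ (4 : ℕ) = 4 := Or.inr rfl
  have h2 : (2 : ℕ) = 2 ∨ (2 : ℕ) = 4 := Or.inl rfl
  -- memberships
  have hmemL : ∀ (N : ℕ) (h : Fin N → TestFn), wick ω₂ 1 N h ∈ Z.localObs := fun N h =>
    mem_localObs_of_mem_localPolynomials Z hcar hoff hloc (hmemP N h)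
  have hconstL : (fun _ : ChainConfig => c₀) ∈ Z.localObs :=
    mem_localObs_of_mem_localPolynomials Z hcar hoff hloc (const_mem_localPolynomials c₀)
  set Pobs : ChainConfig → ℝ := fun σ : ChainConfig => (∑ j : Fin J, c j * wick ω₂ 1 4 (f j) σ) +
      (∑ j : Fin J', d j * wick ω₂ 1 2 (g j) σ) + c₀ with hPobs
  have hPmem : Pobs ∈ Z.localObs := by
    have hm := presentation_comp_mem Z ω₂ c f d g c₀ id (fun j => by simpa using hmemL 4 (f j))
      (fun j => by simpa using hmemL 2 (g j)) hconstL
    simpa using hm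
  set Ψ : ChaosSpace := (∑ j, (c j : ℂ) • wickVector ω₂ 1 (f j)) + ∑ j, (d j : ℂ) • wickVector ω₂ 1 (g j)
    with hΨ
  -- the landed generator stub C on monomials
  have hgen : ∀ h : Fin N → TestFn, HasDerivAt
      (fun s : ℝ => (Z.koopman s (Z.fluct (wick ω₂ 1 N h)) : ZeroWavenumberSpace Z))
      (Z.fluct (liouvilleZ (pinnedChain ω₂ 0 0 1) (wick ω₂ 1 N h))) 0 := fun h =>
    stub_pencilDerivation_domain ω₂ 0 0 1 D Z hcar hoff hU hloc _ (hmemP N h)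
  -- the family `G` and the data of the closed system
  set A : (Fin N → TestFn) → ℝ → ℝ := fun h s => Z.form Pobs (wick ω₂ 1 N h ∘ D.flow s) with hA
  set R : (Fin N → TestFn) → ℝ → ℝ := fun h s =>
    (⟪Ψ, chaosKoopman ω₂ s (wickVector ω₂ 1 h)⟫_ℂ).re with hR
  set G : (Fin N → TestFn) → ℝ → ℝ := fun h s => A h s - R h s with hG
  set τ : (Fin N → TestFn) → Fin N → (Fin N → TestFn) := fun h k => Function.update h k (L (h k)) with hτ
  set W : (Fin N → TestFn) → ℝ := fun h => ∏ i, (⨆ k, ‖thermalWave ω₂ 1 (h i) k‖) with hW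
  set CN : ℝ := ((finite_sectorIndex_sum N).toFinset.card : ℝ) * N.factorial with hCN
  have hCN0 : 0 ≤ CN := mul_nonneg (Nat.cast_nonneg _) (Nat.cast_nonneg _)
  have hW0 : ∀ h, 0 ≤ W h := fun h =>
    Finset.prod_nonneg fun i _ => ciSup_norm_thermalWave_nonneg ω₂ 1 (h i)
  -- `A` as a matrix coefficient of the Koopman group
  have hAinner : ∀ (h : Fin N → TestFn) (s : ℝ),
      A h s = ⟪Z.fluct Pobs, Z.koopman s (Z.fluct (wick ω₂ 1 N h))⟫_ℝ := fun h s =>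
    (Z.toFluctuationDynamics.inner_fluct_koopman_fluct s hPmem (hmemL N h)).symm
  -- norms: `‖[v]‖₀ = ‖ι[v]‖`
  have hnorm : ∀ h : Fin N → TestFn, ‖Z.fluct (wick ω₂ 1 N h)‖ = ‖wickVector ω₂ 1 h‖ := by
    intro h
    have h1 : ‖Z.fluct (wick ω₂ 1 N h)‖ ^ 2 = ‖wickVector ω₂ 1 h‖ ^ 2 := by
      rw [FluctuationStructure.norm_fluct_sq (hmemL N h), Z.form_eq_tsum (hmemL N h) (hmemL N h),
        (hK2Z N N h h hN hN).2, ← inner_self_eq_norm_sq (𝕜 := ℂ), RCLike.re_to_complex]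
    exact (sq_eq_sq₀ (norm_nonneg _) (norm_nonneg _)).1 h1
  suffices hzero : ∀ (h : Fin N → TestFn) (s : ℝ), G h s = 0 by
    have hz := hzero h t
    simp only [hG, hA, hR] at hz
    exact sub_eq_zero.1 hz
  refine linear_ode_family_eq_zero (G' := fun h s => ∑ k, G (τ h k) s) (τ := τ) (W := W)
    (L := N * Real.sqrt (|ω₂| + 4)) (M := (‖Z.fluct Pobs‖ + ‖Ψ‖) * CN)
    (mul_nonneg (Nat.cast_nonneg _) (Real.sqrt_nonneg _))
    (mul_nonneg (add_nonneg (norm_nonneg _) (norm_nonneg _)) hCN0) ?_ ?_ ?_ ?_ ?_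
  · -- growth of the weights
    intro h
    simpa only [hW, hτ] using sum_prod_ciSup_update_le hω 1 hwave h
  · -- the closed system of ODEs
    intro h s
    -- left: the landed generator identity, transported along the group
    have hA' : HasDerivAt (A h) (∑ k, A (τ h k) s) s := by
      have e1 : A h = fun s => ⟪Z.fluct Pobs, Z.koopman s (Z.fluct (wick ω₂ 1 N h))⟫_ℝ :=
        funext fun s => hAinner h s
      rw [e1]
      refine (hasDerivAt_inner_koopman_fluct Z (Z.fluct Pobs) (hgen h) s).congr_deriv ?_
      rw [hLiou N h, fluct_sum Z _ (fun k _ => hmemL N _), map_sum, inner_sum]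
      exact Finset.sum_congr rfl fun k _ => (hAinner (τ h k) s).symm
    -- right: the slot rule under the free evolution
    have hR' : HasDerivAt (R h) (∑ k, R (τ h k) s) s := by
      have e3 : (fun s : ℝ => ⟪Ψ, chaosKoopman ω₂ s (wickVector ω₂ 1 h)⟫_ℂ) = fun s : ℝ =>
          ∑ j, (c j : ℂ) * ⟪wickVector ω₂ 1 (f j), chaosKoopman ω₂ s (wickVector ω₂ 1 h)⟫_ℂ +
            ∑ j, (d j : ℂ) * ⟪wickVector ω₂ 1 (g j), chaosKoopman ω₂ s (wickVector ω₂ 1 h)⟫_ℂ :=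
        funext fun s => inner_presentation ω₂ 1 c f d g _
      have e4 : HasDerivAt (fun s : ℝ => ⟪Ψ, chaosKoopman ω₂ s (wickVector ω₂ 1 h)⟫_ℂ)
          (∑ j, (c j : ℂ) * ∑ k, ⟪wickVector ω₂ 1 (f j), chaosKoopman ω₂ s (wickVector ω₂ 1 (τ h k))⟫_ℂ +
            ∑ j, (d j : ℂ) * ∑ k, ⟪wickVector ω₂ 1 (g j), chaosKoopman ω₂ s (wickVector ω₂ 1 (τ h k))⟫_ℂ) s := by
        rw [e3]
        exact (HasDerivAt.fun_sum fun j _ =>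
            (hasDerivAt_inner_wickVector_chaosKoopman hω hwave (f j) h s).const_mul _).add
          (HasDerivAt.fun_sum fun j _ =>
            (hasDerivAt_inner_wickVector_chaosKoopman hω hwave (g j) h s).const_mul _)
      have e5 := Complex.reCLM.hasFDerivAt.comp_hasDerivAt s e4
      have e6 : HasDerivAt (R h) (Complex.reCLM
          (∑ j, (c j : ℂ) * ∑ k, ⟪wickVector ω₂ 1 (f j), chaosKoopman ω₂ s (wickVector ω₂ 1 (τ h k))⟫_ℂ +
            ∑ j, (d j : ℂ) * ∑ k, ⟪wickVector ω₂ 1 (g j), chaosKoopman ω₂ s (wickVector ω₂ 1 (τ h k))⟫_ℂ)) s :=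
        e5.congr_of_eventuallyEq (Eventually.of_forall fun s => by simp [hR])
      refine e6.congr_deriv ?_
      rw [Complex.reCLM_apply, Complex.add_re, Complex.re_sum, Complex.re_sum]
      simp only [Complex.re_ofReal_mul, Complex.re_sum, Finset.mul_sum]
      rw [Finset.sum_comm, Finset.sum_comm (f := fun j k => d j * _), ← Finset.sum_add_distrib]
      refine Finset.sum_congr rfl fun k _ => ?_
      simp only [hR]
      rw [re_inner_presentation]
    show HasDerivAt (fun s => A h s - R h s) (∑ k, G (τ h k) s) s
    refine (hA'.sub hR').congr_deriv ?_
    simp only [hG]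
    rw [Finset.sum_sub_distrib]
  · intro h s
    exact Finset.abs_sum_le_sum_abs _ _
  · -- initial values: the static shell formula
    intro h
    simp only [hG, hA, hR]
    rw [flow_zero_eq_id hcar hoff, comp_id, chaosKoopman_zero, form_presentation_left Z ω₂ c f d g c₀
      (fun j => hmemL 4 (f j)) (fun j => hmemL 2 (g j)) hconstL (hmemL N h), re_inner_presentation, sub_eq_zero]
    congr 1
    · refine Finset.sum_congr rfl fun j _ => ?_
      rw [Z.form_eq_tsum (hmemL 4 (f j)) (hmemL N h), (hK2Z 4 N (f j) h h4 hN).2]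
    · refine Finset.sum_congr rfl fun j _ => ?_
      rw [Z.form_eq_tsum (hmemL 2 (g j)) (hmemL N h), (hK2Z 2 N (g j) h h2 hN).2]
  · -- uniform bound: Cauchy–Schwarz on both sides
    intro h s
    have hv := norm_wickVector_le hω 1 h
    have hAb : |A h s| ≤ ‖Z.fluct Pobs‖ * (CN * W h) := by
      rw [hAinner]
      refine (abs_real_inner_le_norm _ _).trans ?_
      rw [LinearIsometryEquiv.norm_map, hnorm]
      exact mul_le_mul_of_nonneg_left hv (norm_nonneg _)
    have hRb : |R h s| ≤ ‖Ψ‖ * (CN * W h) := by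
      simp only [hR]
      refine (Complex.abs_re_le_norm _).trans ((norm_inner_le_norm _ _).trans ?_)
      rw [LinearIsometryEquiv.norm_map]
      exact mul_le_mul_of_nonneg_left hv (norm_nonneg _)
    simp only [hG]
    calc |A h s - R h s| ≤ |A h s| + |R h s| := abs_sub _ _
      _ ≤ ‖Z.fluct Pobs‖ * (CN * W h) + ‖Ψ‖ * (CN * W h) := add_le_add hAb hRb
      _ = (‖Z.fluct Pobs‖ + ‖Ψ‖) * CN * W h := by ring

end Core

/-- **STUB K6** (L): the harmonic spectral formula for Wick polynomials (ODE uniqueness in `ℋ₀`):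
`Z.form P (P ∘ φ_t) = Re ⟪Ψ_P, chaosKoopman ω₂ t Ψ_P⟫` for every presented Wick polynomial `P` of the harmonic chain.
[cite: Doyon2022, §4.2–4.3 Thm 4.11] [cite: Janson1997, Thm 4.5] -/
theorem stub_wickShellDynamic :
    (∀ ω₂ γ : ℝ, 0 < ω₂ → ∀ μ : MeasureTheory.Measure ChainConfig,
    (pinnedChain ω₂ 0 0 γ).IsChainGibbsMeasure 1 μ → IsShiftInvariant μ →
      ∀ (N M : ℕ) (f : Fin N → TestFn) (g : Fin M → TestFn), (N = 2 ∨ N = 4) → (M = 2 ∨ M = 4) →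
        Summable (fun y : ℤ => cov[wick ω₂ 1 N f, wick ω₂ 1 M g ∘ chainShift y; μ]) ∧
        ∑' y : ℤ, cov[wick ω₂ 1 N f, wick ω₂ 1 M g ∘ chainShift y; μ] = (⟪wickVector ω₂ 1 f, wickVector ω₂ 1 g⟫_ℂ).re) →
  ((∀ (ω₂ T : ℝ) (N : ℕ) (f : Fin N → TestFn), wick ω₂ T N f ∈ Algebra.adjoin ℝ (Set.range fun xc : ℤ × Bool => fun σ : ChainConfig => if xc.2 then (σ xc.1).2 else (σ xc.1).1)) ∧
  (∀ (ω₂ γ T : ℝ), 0 < ω₂ → ∀ (N : ℕ) (f : Fin N → TestFn) (σ : ChainConfig),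
      liouvilleZ (pinnedChain ω₂ 0 0 γ) (wick ω₂ T N f) σ =
        ∑ i : Fin N, wick ω₂ T N (Function.update f i ((-(ω₂ + 2)) • (f i).2 + Finsupp.mapDomain (fun x : ℤ => x + 1) (f i).2 + Finsupp.mapDomain (fun x : ℤ => x - 1) (f i).2, (f i).1)) σ) ∧
  (∀ (ω₂ T : ℝ), 0 < ω₂ → ∀ (f : TestFn) (k : 𝕋),
      thermalWave ω₂ T ((-(ω₂ + 2)) • f.2 + Finsupp.mapDomain (fun x : ℤ => x + 1) f.2 + Finsupp.mapDomain (fun x : ℤ => x - 1) f.2, f.1) k = -Complex.I * (PinnedChainKinetic.dispersion ω₂ k : ℂ) * thermalWave ω₂ T f k) ∧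
  (∀ (ω₂ T : ℝ), 0 < ω₂ → ∀ f g : TestFn,
      thermalCov ω₂ T ((-(ω₂ + 2)) • f.2 + Finsupp.mapDomain (fun x : ℤ => x + 1) f.2 + Finsupp.mapDomain (fun x : ℤ => x - 1) f.2, f.1) g = -thermalCov ω₂ T f ((-(ω₂ + 2)) • g.2 + Finsupp.mapDomain (fun x : ℤ => x + 1) g.2 + Finsupp.mapDomain (fun x : ℤ => x - 1) g.2, g.1))) →
  ∀ ω₂ : ℝ, 0 < ω₂ →
    ∀ (D : InfiniteChainDynamics (pinnedChain ω₂ 0 0 1)) (Z : ZeroWavenumberData (pinnedChain ω₂ 0 0 1) D),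
      (pinnedChain ω₂ 0 0 1).IsChainGibbsMeasure 1 Z.μ →
      D.carrier = (pinnedChain ω₂ 0 0 1).bmGood →
      (∀ (t : ℝ) (σ : ChainConfig), σ ∉ (pinnedChain ω₂ 0 0 1).bmGood → D.flow t σ = σ) →
      Z.toFluctuationDynamics.IsStronglyContinuous →
      Z.localObs = Submodule.span ℝ {w : ChainConfig → ℝ | ∃ u ∈ Algebra.adjoin ℝ (Set.range fun xc : ℤ × Bool => fun σ : ChainConfig => if xc.2 then (σ xc.1).2 else (σ xc.1).1), ∃ s : ℝ, w = u ∘ D.flow s} →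
      ∀ (J : ℕ) (c : Fin J → ℝ) (f : Fin J → Fin 4 → TestFn) (J' : ℕ) (d : Fin J' → ℝ) (g : Fin J' → Fin 2 → TestFn) (c₀ : ℝ) (t : ℝ),
        Z.form (fun σ : ChainConfig => (∑ j : Fin J, c j * wick ω₂ 1 4 (f j) σ) + (∑ j : Fin J', d j * wick ω₂ 1 2 (g j) σ) + c₀)
          ((fun σ : ChainConfig => (∑ j : Fin J, c j * wick ω₂ 1 4 (f j) σ) + (∑ j : Fin J', d j * wick ω₂ 1 2 (g j) σ) + c₀) ∘ D.flow t) =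
          (⟪((∑ j : Fin J, (c j : ℂ) • wickVector ω₂ 1 (f j)) + ∑ j : Fin J', (d j : ℂ) • wickVector ω₂ 1 (g j)),
            chaosKoopman ω₂ t ((∑ j : Fin J, (c j : ℂ) • wickVector ω₂ 1 (f j)) + ∑ j : Fin J', (d j : ℂ) • wickVector ω₂ 1 (g j))⟫_ℂ).re := by
  intro hK2 hAlg ω₂ hω D Z hG hcar hoff hU hloc J c f J' d g c₀ t
  classical
  -- the state is THE shift-invariant DLR state, so the static shell formula applies to it
  have hS : IsShiftInvariant Z.μ := by
    have h := (Z.measurePreserving_shift 1).map_eq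
    rwa [chainShift_one] at h
  have hK2Z := hK2 ω₂ 1 hω Z.μ hG hS
  -- the pencil's algebra at the harmonic point (KAlg)
  set L : TestFn → TestFn := fun θ => ((-(ω₂ + 2)) • θ.2 + Finsupp.mapDomain (fun x : ℤ => x + 1) θ.2 +
    Finsupp.mapDomain (fun x : ℤ => x - 1) θ.2, θ.1) with hL
  have hmemP : ∀ (N : ℕ) (h : Fin N → TestFn), wick ω₂ 1 N h ∈ Algebra.adjoin ℝ
      (Set.range fun xc : ℤ × Bool => fun σ : ChainConfig => if xc.2 then (σ xc.1).2 else (σ xc.1).1) :=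
    fun N h => hAlg.1 ω₂ 1 N h
  have hLiou : ∀ (N : ℕ) (h : Fin N → TestFn), liouvilleZ (pinnedChain ω₂ 0 0 1) (wick ω₂ 1 N h) =
      ∑ i, wick ω₂ 1 N (Function.update h i (L (h i))) := by
    intro N h
    funext σ
    rw [Finset.sum_apply]
    exact hAlg.2.1 ω₂ 1 1 hω N h σ
  have hwave : ∀ (θ : TestFn) (k : 𝕋), thermalWave ω₂ 1 (L θ) k =
      -Complex.I * (PinnedChainKinetic.dispersion ω₂ k : ℂ) * thermalWave ω₂ 1 θ k :=
    fun θ k => hAlg.2.2.1 ω₂ 1 hω θ k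
  -- memberships
  have hmemL : ∀ (N : ℕ) (h : Fin N → TestFn), wick ω₂ 1 N h ∈ Z.localObs := fun N h =>
    mem_localObs_of_mem_localPolynomials Z hcar hoff hloc (hmemP N h)
  have hconstL : (fun _ : ChainConfig => c₀) ∈ Z.localObs :=
    mem_localObs_of_mem_localPolynomials Z hcar hoff hloc (const_mem_localPolynomials c₀)
  have hPmem : (fun σ : ChainConfig => (∑ j : Fin J, c j * wick ω₂ 1 4 (f j) σ) +
      (∑ j : Fin J', d j * wick ω₂ 1 2 (g j) σ) + c₀) ∈ Z.localObs := by
    have hm := presentation_comp_mem Z ω₂ c f d g c₀ id (fun j => by simpa using hmemL 4 (f j))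
      (fun j => by simpa using hmemL 2 (g j)) hconstL
    simpa using hm
  -- the monomial formula (core), then linearity in the second slot on both sides
  have core : ∀ {N : ℕ}, (N = 2 ∨ N = 4) → ∀ h : Fin N → TestFn,
      Z.form (fun σ : ChainConfig => (∑ j : Fin J, c j * wick ω₂ 1 4 (f j) σ) +
        (∑ j : Fin J', d j * wick ω₂ 1 2 (g j) σ) + c₀) (wick ω₂ 1 N h ∘ D.flow t) =
      (⟪(∑ j, (c j : ℂ) • wickVector ω₂ 1 (f j)) + ∑ j, (d j : ℂ) • wickVector ω₂ 1 (g j),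
        chaosKoopman ω₂ t (wickVector ω₂ 1 h)⟫_ℂ).re := fun hN h =>
    form_wick_comp_flow_eq_re_inner hω Z hK2Z hmemP hLiou hwave hcar hoff hU hloc c f d g c₀ hN h t
  rw [form_presentation_comp_right Z ω₂ c f d g c₀ (D.flow t) (fun j => Z.comp_flow_mem t (hmemL 4 (f j)))
    (fun j => Z.comp_flow_mem t (hmemL 2 (g j))) hconstL hPmem, re_inner_chaosKoopman_presentation]
  congr 1
  · exact Finset.sum_congr rfl fun j _ => by rw [core (Or.inr rfl) (f j)]
  · exact Finset.sum_congr rfl fun j _ => by rw [core (Or.inl rfl) (g j)]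

end Summit.AtomisticToContinuum.FouriersLaw.Theorems.DrudeDissolution.GramPencilHarmonicChaos

end
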